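import Literature.NumberTheory.Automorphic.AdelicBoxCount
import Literature.NumberTheory.Automorphic.IdelicDyadicUnfolding
import Literature.NumberTheory.Automorphic.IdeleModuleProofs
import Literature.NumberTheory.Automorphic.ReductionTheoryGLnConjugation
import HarnessLib

/-!
# Rational points on a dilated and shifted adelic line: ESCAPE and BOX COUNT

Topic `NumberTheory/Automorphic`; namespace `Literature.NumberTheory.Automorphic`. Proof file
(theorems only: no definition, no named fact, no instance, no `sorry`); generic number field `K`,
`𝔸 = AdeleRing (𝓞 K) K`, `𝕀 = 𝔸ˣ`, `‖b‖ = IdeleClassGroup.ideleNorm K b`, `d = [K:ℚ]`.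

Two elementary counting facts about the rational points `t ∈ K` of the affine line
`t ↦ λ t + s` (`λ ∈ 𝕀`, `s ∈ 𝔸`) meeting a fixed compact set `C ⊆ 𝔸`, uniformly in the shift `s`
and polynomially in the dilation `λ` — the bookkeeping of the unipotent lattice sums
`Σ_{t ∈ F} h(λ t + s)` of the parabolic terms of the rank-one trace formula (Gelbart (1975), proof
of Lemma 9.13; Rogawski (1990), §7.2, proof of Prop. 7.2.2: the sum is empty deep in one direction
of the cusp and has `O(‖λ‖⁻¹)` terms in the other):

* §1 `exists_ideleNorm_le_of_coe_mem` — **the idele norm is bounded on the ideles lying in a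
  compact adelic set**: `↑x ∈ C ⇒ ‖x‖ ≤ c₀(C)`. Proof by Tate's Lemma 4.1.2 in Mathlib's form
  (★ `AdeleRing.addHaar_smul_eq_ideleNorm_mul`: `μ(x • B) = ‖x‖ μ(B)`) applied to a compact
  neighbourhood `B` of `0`: `x • B ⊆ C · B`, so `‖x‖ ≤ μ(C · B) / μ(B)`.
* §1 `exists_forall_mul_algebraMap_notMem` — **ESCAPE**: there is `c₀` with
  `c₀ < ‖a‖ ⇒ a · t ∉ C` for every `t ∈ Kˣ` (product formula ★ `ideleNorm_principal`:
  `‖a t‖ = ‖a‖`).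
* §2 `exists_ncard_mul_algebraMap_add_mem_le` — **BOX COUNT**: there is `c₁ > 0` with
  `#{t ∈ K : λ t + s ∈ C} ≤ c₁ · max(1, ‖λ‖⁻¹)` for all `λ ∈ 𝕀`, `s ∈ 𝔸` (and the set is finite):
  removing the shift (`λ (t − t₀) ∈ C − C`), writing `λ⁻¹ = k₀ · z(r) · q` with `k₀ ∈ Kˣ`,
  `z(r)` the positive real idele with `r^d = ‖λ‖⁻¹` and `q` in the fixed compact set `P · W` of
  ★ `IdelicDyadicUnfolding` (`exists_principalIdele_mul_mem_dyadicIdeleSet`, the compactness of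
  `𝕀¹/Kˣ`), and counting `k ∈ K` with `k ∈ z(r) · ((P · W) · (C − C))` by
  ★ `ncard_algebraMap_mem_realAdele_smul_le` (`AdelicBoxCount`): `≤ c₁ max(1, r)^d`.

Cell `hodgecm-mathlib`, ENGINE T1 (crux H413 = `stmt-HodgeConjecture-24833`), T1-qs road LAW 5,
core of the analytic lemma «lattice sum vs integral along a line in the cusp» ((P4), (P5) of the
(b2-β) / (b2-α′) / (L5-iii-c) letters). HC_CM is proved only modulo the printed citations until
rung 0 closes; this file is unconditional and touches no binder.

## References

* S. Gelbart, *Automorphic forms on adele groups*, Ann. of Math. Studies 83 (1975), Lemma 9.13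
  [Gelbart1975].
* J. Rogawski, *Automorphic representations of unitary groups in three variables*, Ann. of Math.
  Studies 123 (1990), §7.2 [Rogawski1990].
* J. W. S. Cassels, A. Fröhlich (eds.), *Algebraic Number Theory* (1967), Ch. II §16, Ch. XV
  Lemma 4.1.2 [CasselsFrohlichANT1967].
-/

set_option autoImplicit false

noncomputable section

open MeasureTheory Measure NumberField IsDedekindDomain Set Filter
open scoped ENNReal NNReal Pointwise Topology

namespace Literature.NumberTheory.Automorphic

variable (K : Type) [Field K] [NumberField K]

/-! ## §1 The idele norm on a compact adelic set; escape -/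

section Escape

/-- **The idele norm is bounded on the ideles lying in a compact adelic set**: for compact
`C ⊆ 𝔸_K` there is `c₀ ≥ 0` with `‖x‖ ≤ c₀` for every idele `x` with `↑x ∈ C`. (Haar-module
proof: for a compact neighbourhood `B` of `0`, `‖x‖ · μ(B) = μ(x • B) ≤ μ(C · B) < ∞`.)
[cite: CasselsFrohlichANT1967, Ch. XV Lemma 4.1.2] -/
theorem exists_ideleNorm_le_of_coe_mem {C : Set (AdeleRing (𝓞 K) K)} (hC : IsCompact C) :
    ∃ c₀ : ℝ, 0 ≤ c₀ ∧ ∀ x : (AdeleRing (𝓞 K) K)ˣ, (x : AdeleRing (𝓞 K) K) ∈ C →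
      (IdeleClassGroup.ideleNorm K x : ℝ) ≤ c₀ := by
  letI : MeasurableSpace (AdeleRing (𝓞 K) K) := borel _
  haveI : BorelSpace (AdeleRing (𝓞 K) K) := ⟨rfl⟩
  haveI : LocallyCompactSpace (AdeleRing (𝓞 K) K) := locallyCompactSpace_adeleRing' K
  set μ : Measure (AdeleRing (𝓞 K) K) := Measure.addHaar with hμ
  obtain ⟨B, hBc, hB0⟩ := exists_compact_mem_nhds (0 : AdeleRing (𝓞 K) K)
  have hμB0 : μ B ≠ 0 := (measure_pos_of_mem_nhds μ hB0).ne'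
  have hμB : μ B ≠ ∞ := hBc.measure_lt_top.ne
  have hCB : IsCompact (C * B) := hC.mul hBc
  have hμCB : μ (C * B) ≠ ∞ := hCB.measure_lt_top.ne
  refine ⟨(μ (C * B)).toReal / (μ B).toReal, by positivity, fun x hx => ?_⟩
  have hsub : x • B ⊆ C * B := by
    rintro _ ⟨b, hb, rfl⟩
    exact ⟨(x : AdeleRing (𝓞 K) K), hx, b, hb, rfl⟩
  have hle : (IdeleClassGroup.ideleNorm K x : ℝ≥0∞) * μ B ≤ μ (C * B) := by
    rw [← AdeleRing.addHaar_smul_eq_ideleNorm_mul K μ x B]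
    exact measure_mono hsub
  rw [le_div_iff₀ (ENNReal.toReal_pos hμB0 hμB)]
  have h := ENNReal.toReal_mono hμCB hle
  rwa [ENNReal.toReal_mul, ENNReal.coe_toReal] at h

/-- **ESCAPE**: for compact `C ⊆ 𝔸_K` there is `c₀ ≥ 0` such that no idele `a` with `c₀ < ‖a‖`
has a rational multiple `a · t`, `t ∈ Kˣ`, inside `C` (product formula: `‖a · t‖ = ‖a‖`).
[cite: CasselsFrohlichANT1967, Ch. II §16 Theorem (product formula)] -/
theorem exists_forall_mul_algebraMap_notMem {C : Set (AdeleRing (𝓞 K) K)} (hC : IsCompact C) :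
    ∃ c₀ : ℝ, 0 ≤ c₀ ∧ ∀ a : (AdeleRing (𝓞 K) K)ˣ, c₀ < (IdeleClassGroup.ideleNorm K a : ℝ) →
      ∀ t : Kˣ, (a : AdeleRing (𝓞 K) K) * algebraMap K (AdeleRing (𝓞 K) K) (t : K) ∉ C := by
  obtain ⟨c₀, hc₀, h⟩ := exists_ideleNorm_le_of_coe_mem K hC
  refine ⟨c₀, hc₀, fun a ha t ht => ?_⟩
  have hmem : ((a * principalIdele K t : (AdeleRing (𝓞 K) K)ˣ) : AdeleRing (𝓞 K) K) ∈ C := by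
    rw [Units.val_mul]
    exact ht
  have hle := h _ hmem
  rw [map_mul, ideleNorm_principal ⟨t, rfl⟩, mul_one] at hle
  exact absurd hle (not_le.2 ha)

/-- **ESCAPE, shifted-line form**: for compact `C ⊆ 𝔸_K` there is `c₀ ≥ 0` such that for every
idele `a` with `c₀ < ‖a‖` the set `{t ∈ K : t ≠ 0, a · t ∈ C}` is empty — the unipotent lattice
sum over `t ≠ 0` is empty deep in the cusp. [cite: Gelbart1975, Lemma 9.13 (proof)] -/
theorem exists_forall_setOf_mul_algebraMap_mem_eq_empty {C : Set (AdeleRing (𝓞 K) K)}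
    (hC : IsCompact C) :
    ∃ c₀ : ℝ, 0 ≤ c₀ ∧ ∀ a : (AdeleRing (𝓞 K) K)ˣ, c₀ < (IdeleClassGroup.ideleNorm K a : ℝ) →
      {t : K | t ≠ 0 ∧ (a : AdeleRing (𝓞 K) K) * algebraMap K (AdeleRing (𝓞 K) K) t ∈ C} = ∅ := by
  obtain ⟨c₀, hc₀, h⟩ := exists_forall_mul_algebraMap_notMem K hC
  refine ⟨c₀, hc₀, fun a ha => Set.eq_empty_iff_forall_notMem.2 fun t ht => ?_⟩
  exact h a ha (Units.mk0 t ht.1) ht.2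

end Escape

/-! ## §2 Box count on a dilated and shifted line -/

section BoxCount

/-- `(max 1 r) ^ d = max 1 (r ^ d)` for `r ≥ 0`. [folklore] -/
private theorem max_one_pow_eq {r : ℝ} (hr : 0 ≤ r) (d : ℕ) : max 1 r ^ d = max 1 (r ^ d) := by
  rcases le_total 1 r with h | h
  · rw [max_eq_right h, max_eq_right (one_le_pow₀ h)]
  · rw [max_eq_left h, one_pow, max_eq_left (pow_le_one₀ hr h)]

/-- **BOX COUNT**: for compact `C ⊆ 𝔸_K` there is `c₁ > 0` such that for every idele `λ` and every
adele `s` the rational points `t ∈ K` with `λ t + s ∈ C` are finite in number, at most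
`c₁ · max(1, ‖λ‖⁻¹)` — uniformly in the shift `s` (Gelbart (1975), proof of Lemma 9.13: the number
of terms of the unipotent lattice sum in the cusp). Proof: the differences `t − t₀` of two solutions
satisfy `λ (t − t₀) ∈ C − C`; `λ⁻¹ = k₀ · z(r) · q` with `k₀ ∈ Kˣ`, `r^d = ‖λ‖⁻¹`, `q ∈ P · W`
compact (★ `exists_principalIdele_mul_mem_dyadicIdeleSet`); count by ★
`ncard_algebraMap_mem_realAdele_smul_le` in the compact box `(P · W) · (C − C)`.
[cite: Gelbart1975, Lemma 9.13 (proof)] -/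
theorem exists_ncard_mul_algebraMap_add_mem_le {C : Set (AdeleRing (𝓞 K) K)} (hC : IsCompact C) :
    ∃ c₁ : ℝ, 0 < c₁ ∧ ∀ lam : (AdeleRing (𝓞 K) K)ˣ, ∀ s : AdeleRing (𝓞 K) K,
      {t : K | (lam : AdeleRing (𝓞 K) K) * algebraMap K (AdeleRing (𝓞 K) K) t + s ∈ C}.Finite ∧
        (({t : K | (lam : AdeleRing (𝓞 K) K) * algebraMap K (AdeleRing (𝓞 K) K) t + s ∈ C}.ncard
            : ℕ) : ℝ) ≤
          c₁ * max 1 ((IdeleClassGroup.ideleNorm K lam : ℝ)⁻¹) := by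
  -- the fixed compact box `B = (P W) • (C - C)`
  set Q : Set (AdeleRing (𝓞 K) K)ˣ := posRealIdeleSegment K * normOneIdeleCover K with hQ
  have hQc : IsCompact Q := (isCompact_posRealIdeleSegment K).mul (isCompact_normOneIdeleCover K)
  set B : Set (AdeleRing (𝓞 K) K) :=
    (fun p : (AdeleRing (𝓞 K) K)ˣ × (AdeleRing (𝓞 K) K × AdeleRing (𝓞 K) K) =>
      (p.1 : AdeleRing (𝓞 K) K) * (p.2.1 - p.2.2)) '' (Q ×ˢ (C ×ˢ C)) with hB
  have hBc : IsCompact B :=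
    (hQc.prod (hC.prod hC)).image
      ((Units.continuous_val.comp continuous_fst).mul
        ((continuous_fst.comp continuous_snd).sub (continuous_snd.comp continuous_snd)))
  obtain ⟨c₁, hc₁, hcount⟩ := ncard_algebraMap_mem_realAdele_smul_le K hBc
  refine ⟨c₁, hc₁, fun lam s => ?_⟩
  set S : Set K := {t : K | (lam : AdeleRing (𝓞 K) K) * algebraMap K (AdeleRing (𝓞 K) K) t + s ∈ C}
    with hS
  rcases S.eq_empty_or_nonempty with hS0 | ⟨t₀, ht₀⟩
  · refine ⟨by rw [hS0]; exact Set.finite_empty, ?_⟩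
    rw [hS0, Set.ncard_empty, Nat.cast_zero]
    exact mul_nonneg hc₁.le (le_trans zero_le_one (le_max_left _ _))
  -- dyadic decomposition of `λ⁻¹ = k₀ · z(r) · q`, `r ^ d = ‖λ‖⁻¹`
  have hd : (0 : ℝ) < Module.finrank ℚ K := Nat.cast_pos.2 Module.finrank_pos
  set N : ℝ := (IdeleClassGroup.ideleNorm K lam⁻¹ : ℝ) with hN
  have hN0 : 0 < N := NNReal.coe_pos.2 (pos_iff_ne_zero.2 (ideleNorm_ne_zero lam⁻¹))
  have hNinv : N = (IdeleClassGroup.ideleNorm K lam : ℝ)⁻¹ := by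
    rw [hN, map_inv, NNReal.coe_inv]
  set r : ℝ≥0ˣ := Units.mk0 ⟨N ^ ((Module.finrank ℚ K : ℝ)⁻¹), Real.rpow_nonneg hN0.le _⟩
    (by
      intro h
      have := congrArg (fun t : ℝ≥0 => (t : ℝ)) h
      simp only [NNReal.coe_zero] at this
      exact (Real.rpow_pos_of_pos hN0 _).ne' this) with hr
  have hr0 : 0 < ((r : ℝ≥0) : ℝ) := NNReal.coe_pos.2 (pos_iff_ne_zero.2 r.ne_zero)
  have hrN : ((r : ℝ≥0) : ℝ) ^ Module.finrank ℚ K = N := by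
    change (N ^ ((Module.finrank ℚ K : ℝ)⁻¹)) ^ Module.finrank ℚ K = N
    rw [← Real.rpow_natCast, ← Real.rpow_mul hN0.le, inv_mul_cancel₀ hd.ne', Real.rpow_one]
  obtain ⟨k₀, y', hy', hyy'⟩ := exists_principalIdele_mul_mem_dyadicIdeleSet K r (x := lam⁻¹)
    (by rw [hrN]; linarith) (by rw [hrN]; linarith)
  obtain ⟨q, hq, hqy⟩ := Set.mem_smul_set.1 hy'
  -- the injection `t ↦ k₀⁻¹ (t - t₀)` into the rational points of `z(r) • B`
  set T : Set K := {k : K | algebraMap K (AdeleRing (𝓞 K) K) k ∈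
    realAdele K ((r : ℝ≥0) : ℝ) • B} with hT
  obtain ⟨hTfin, hTle⟩ := hcount ((r : ℝ≥0) : ℝ) hr0
  set f : K → K := fun t => ((k₀⁻¹ : Kˣ) : K) * (t - t₀) with hf
  have hval : ((lam⁻¹ : (AdeleRing (𝓞 K) K)ˣ) : AdeleRing (𝓞 K) K) =
      ((principalIdele K k₀ : (AdeleRing (𝓞 K) K)ˣ) : AdeleRing (𝓞 K) K) *
        (realAdele K ((r : ℝ≥0) : ℝ) * (q : AdeleRing (𝓞 K) K)) := by
    rw [hyy', Units.val_mul, ← hqy, smul_eq_mul, Units.val_mul, coe_posRealIdele]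
  have hk₀ : algebraMap K (AdeleRing (𝓞 K) K) ((k₀⁻¹ : Kˣ) : K) =
      (((principalIdele K k₀)⁻¹ : (AdeleRing (𝓞 K) K)ˣ) : AdeleRing (𝓞 K) K) := by
    rw [← map_inv]
    rfl
  have hmaps : Set.MapsTo f S T := by
    intro t ht
    set c : AdeleRing (𝓞 K) K :=
      ((lam : AdeleRing (𝓞 K) K) * algebraMap K (AdeleRing (𝓞 K) K) t + s) -
        ((lam : AdeleRing (𝓞 K) K) * algebraMap K (AdeleRing (𝓞 K) K) t₀ + s) with hc
    have hcB : (q : AdeleRing (𝓞 K) K) * c ∈ B := ⟨(q, (_, _)), ⟨hq, ht, ht₀⟩, rfl⟩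
    -- `λ (t - t₀) = c`, so `t - t₀ = λ⁻¹ c`
    have e1 : algebraMap K (AdeleRing (𝓞 K) K) (t - t₀) =
        ((lam⁻¹ : (AdeleRing (𝓞 K) K)ˣ) : AdeleRing (𝓞 K) K) * c := by
      have e : (lam : AdeleRing (𝓞 K) K) * algebraMap K (AdeleRing (𝓞 K) K) (t - t₀) = c := by
        rw [hc, map_sub]
        ring
      rw [← e, ← mul_assoc, Units.inv_mul, one_mul]
    have key : algebraMap K (AdeleRing (𝓞 K) K) (f t) =
        realAdele K ((r : ℝ≥0) : ℝ) * ((q : AdeleRing (𝓞 K) K) * c) := by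
      rw [hf, map_mul, e1, hk₀, hval, mul_assoc, Units.inv_mul_cancel_left, mul_assoc]
    change algebraMap K (AdeleRing (𝓞 K) K) (f t) ∈ realAdele K ((r : ℝ≥0) : ℝ) • B
    rw [key, ← smul_eq_mul]
    exact Set.smul_mem_smul_set hcB
  have hinj : Set.InjOn f S := by
    intro t _ t' _ htt'
    have h := mul_left_cancel₀ (Units.ne_zero k₀⁻¹) htt'
    exact sub_left_injective h
  have hle : S.ncard ≤ T.ncard := Set.ncard_le_ncard_of_injOn f hmaps hinj hTfin
  have hSfin : S.Finite :=
    Set.Finite.of_finite_image (hTfin.subset (Set.image_subset_iff.2 hmaps)) hinj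
  refine ⟨hSfin, (Nat.cast_le.2 hle).trans (hTle.trans (le_of_eq ?_))⟩
  rw [max_one_pow_eq hr0.le, hrN, hNinv]

end BoxCount

end Literature.NumberTheory.Automorphic
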